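import Literature.NumberTheory.Automorphic.MixedSpaceMomentKernelsFourier
import Literature.NumberTheory.Automorphic.ArchKirillovMirabolicRep
import Literature.Analysis.UnboundedOperators.UnitaryRepSpectralMeasure
import Mathlib.MeasureTheory.Function.AEEqOfLIntegral
import HarnessLib

/-!
# An integrable function on `K_∞ˣ` all of whose character integrals `∫ ψ_∞(u x) F(u) dμ` vanish is zero

Topic `NumberTheory/Automorphic`; namespace `Literature.NumberTheory.Automorphic`. Theorems only (no
definition, no named fact). For `K_∞ = mixedSpace K`, Tate's archimedean character
`ψ_∞(ξ x) = archChar K ξ x = e^{i B(ξ, x)}` (`B = archCharForm K`, non-degenerate), a measure `μ` on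
`K_∞ˣ` and an integrable `F : K_∞ˣ → ℂ`:

* `ae_eq_zero_of_forall_integral_archChar_mul_real` — if `G` is real valued and integrable and
  `∫ ψ_∞(u x) G(u) dμ(u) = 0` for every `x ∈ K_∞`, then `G = 0` a.e. Proof: the finite measures
  `G⁺ μ`, `G⁻ μ` pushed forward along the open embedding `K_∞ˣ ↪ K_∞` have equal transforms
  `∫ e^{iB(ξ,x)}`, hence coincide (Lévy's uniqueness theorem for the non-degenerate form `B`,
  `measure_eq_of_forall_integral_cexp_bilin_eq` of `UnitaryRepSpectralMeasure`), hence `G⁺ = G⁻` a.e.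
* `ae_eq_zero_of_forall_integral_archChar_mul` — the same for complex `F` (apply the real case to
  `Re F` and `Im F`, using `conj ψ_∞(u x) = ψ_∞(u (-x))`).

This is the "Fourier uniqueness" step in the proof that the Kirillov representation of the mirabolic
`P₂(K_∞)` on `L²(K_∞ˣ)` has trivial commutant (an operator commuting with all multiplications by the
characters `u ↦ ψ_∞(u x)` commutes with all bounded multiplications), on the route to the named fact
`Literature.NumberTheory.Automorphic.JacquetShalika1981_archKirillovNorm_le`.

## References

* G. B. Folland, *A Course in Abstract Harmonic Analysis* (1995), Thm. 4.33 (Fourier uniqueness)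
  [Folland1995].
* H. Jacquet, J. A. Shalika, *On Euler products and the classification of automorphic
  representations I*, Amer. J. Math. 103 (1981), §3, (3.5) (irreducibility of `τ_r`) [JacquetShalikaAJM1981].
-/

noncomputable section

open scoped Classical Real ENNReal NNReal ComplexConjugate
open NumberField NumberField.mixedEmbedding NumberField.InfinitePlace MeasureTheory Complex
open Literature.Analysis.UnboundedOperators

namespace Literature.NumberTheory.Automorphic

variable {K : Type} [Field K] [NumberField K]

/-- `conj ψ_∞(ξ x) = ψ_∞(ξ (-x))`. [folklore] -/
theorem conj_archChar (ξ x : mixedSpace K) : conj (archChar K ξ x) = archChar K ξ (-x) := by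
  unfold archChar
  rw [← Complex.exp_conj, map_mul, Complex.conj_ofReal, Complex.conj_I, map_neg, Complex.ofReal_neg]
  ring_nf

/-- The inclusion `K_∞ˣ ↪ K_∞` is a measurable embedding (it is an open embedding, `K_∞` being a complete
normed ring). [folklore] -/
theorem measurableEmbedding_units_val [MeasurableSpace ((mixedSpace K)ˣ)] [BorelSpace ((mixedSpace K)ˣ)] :
    MeasurableEmbedding (Units.val : (mixedSpace K)ˣ → mixedSpace K) :=
  (Units.isOpenEmbedding_val (R := mixedSpace K)).measurableEmbedding

variable [MeasurableSpace ((mixedSpace K)ˣ)] [BorelSpace ((mixedSpace K)ˣ)]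

/-- Products `ψ_∞(u x) w(u)` with an integrable `w` are integrable. [folklore] -/
theorem integrable_archChar_mul {μ : Measure ((mixedSpace K)ˣ)} {w : (mixedSpace K)ˣ → ℂ}
    (hw : Integrable w μ) (x : mixedSpace K) :
    Integrable (fun u : (mixedSpace K)ˣ => archChar K (u : mixedSpace K) x * w u) μ :=
  hw.bdd_mul (c := 1) (continuous_archChar_coe x).measurable.aestronglyMeasurable
    (Filter.Eventually.of_forall fun _ => (norm_archChar K _ _).le)

/-- The transform of a pushed-forward density: for `w ≥ 0` integrable on `K_∞ˣ`,
`∫_{K_∞} e^{iB(ξ,x)} d((w μ)_*)(ξ) = ∫_{K_∞ˣ} ψ_∞(u x) w(u) dμ(u)`. [folklore] -/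
theorem integral_cexp_map_withDensity (μ : Measure ((mixedSpace K)ˣ)) {w : (mixedSpace K)ˣ → ℝ}
    (hw : Integrable w μ) (hw0 : ∀ u, 0 ≤ w u) (x : mixedSpace K) :
    ∫ ξ, cexp ((archCharForm K ξ x : ℝ) * I)
        ∂((μ.withDensity fun u => ENNReal.ofReal (w u)).map (Units.val : (mixedSpace K)ˣ → mixedSpace K)) =
      ∫ u, archChar K (u : mixedSpace K) x * (w u : ℂ) ∂μ := by
  rw [measurableEmbedding_units_val.integral_map,
    integral_withDensity_eq_integral_toReal_smul₀ (hw.1.aemeasurable.ennreal_ofReal)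
      (Filter.Eventually.of_forall fun u => ENNReal.ofReal_lt_top)]
  refine integral_congr_ae (Filter.Eventually.of_forall fun u => ?_)
  show (ENNReal.ofReal (w u)).toReal • cexp ((archCharForm K (u : mixedSpace K) x : ℝ) * I) = _
  rw [ENNReal.toReal_ofReal (hw0 u), Complex.real_smul, mul_comm]
  rfl

/-- **Real case.** An integrable real function `G` on `K_∞ˣ` with `∫ ψ_∞(u x) G(u) dμ = 0` for all
`x ∈ K_∞` vanishes a.e.: the pushforwards of `G⁺ μ` and `G⁻ μ` to `K_∞` are finite measures with the
same transform against the characters `e^{i B(ξ, x)}` of the non-degenerate form `B`, hence equal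
(Lévy), hence `G⁺ = G⁻` a.e. [cite: Folland1995, Thm. 4.33] -/
theorem ae_eq_zero_of_forall_integral_archChar_mul_real (μ : Measure ((mixedSpace K)ˣ))
    {G : (mixedSpace K)ˣ → ℝ} (hG : Integrable G μ)
    (h : ∀ x : mixedSpace K, ∫ u, archChar K (u : mixedSpace K) x * (G u : ℂ) ∂μ = 0) :
    G =ᵐ[μ] 0 := by
  -- the positive and negative parts and the finite measures `ν± = G± μ`
  set Gp : (mixedSpace K)ˣ → ℝ := fun u => max (G u) 0 with hGp
  set Gm : (mixedSpace K)ˣ → ℝ := fun u => max (-G u) 0 with hGm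
  have hGp_int : Integrable Gp μ := hG.pos_part
  have hGm_int : Integrable Gm μ := hG.neg_part
  have hGp0 : ∀ u, 0 ≤ Gp u := fun u => le_max_right _ _
  have hGm0 : ∀ u, 0 ≤ Gm u := fun u => le_max_right _ _
  have hsub : ∀ u, Gp u - Gm u = G u := fun u => by
    simp only [hGp, hGm]
    rcases le_total 0 (G u) with hu | hu
    · rw [max_eq_left hu, max_eq_right (by linarith), sub_zero]
    · rw [max_eq_right hu, max_eq_left (by linarith)]; ring
  set νp : Measure ((mixedSpace K)ˣ) := μ.withDensity fun u => ENNReal.ofReal (Gp u) with hνp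
  set νm : Measure ((mixedSpace K)ˣ) := μ.withDensity fun u => ENNReal.ofReal (Gm u) with hνm
  have hfinp : ∫⁻ u, ENNReal.ofReal (Gp u) ∂μ ≠ ∞ :=
    ((lintegral_ofReal_le_lintegral_enorm Gp).trans_lt hGp_int.2).ne
  have hfinm : ∫⁻ u, ENNReal.ofReal (Gm u) ∂μ ≠ ∞ :=
    ((lintegral_ofReal_le_lintegral_enorm Gm).trans_lt hGm_int.2).ne
  haveI : IsFiniteMeasure νp := isFiniteMeasure_withDensity hfinp
  haveI : IsFiniteMeasure νm := isFiniteMeasure_withDensity hfinm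
  -- the pushforwards to `K_∞` have equal transforms, hence are equal
  set ρp : Measure (mixedSpace K) := νp.map (Units.val : (mixedSpace K)ˣ → mixedSpace K) with hρp
  set ρm : Measure (mixedSpace K) := νm.map (Units.val : (mixedSpace K)ˣ → mixedSpace K) with hρm
  have htrans : ∀ x, ∫ ξ, cexp ((archCharForm K ξ x : ℝ) * I) ∂ρp = ∫ ξ, cexp ((archCharForm K ξ x : ℝ) * I) ∂ρm := by
    intro x
    have h1 : Integrable (fun u : (mixedSpace K)ˣ => archChar K (u : mixedSpace K) x * (Gp u : ℂ)) μ :=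
      integrable_archChar_mul hGp_int.ofReal x
    have h2 : Integrable (fun u : (mixedSpace K)ˣ => archChar K (u : mixedSpace K) x * (Gm u : ℂ)) μ :=
      integrable_archChar_mul hGm_int.ofReal x
    rw [hρp, hρm, hνp, hνm, integral_cexp_map_withDensity μ hGp_int hGp0 x,
      integral_cexp_map_withDensity μ hGm_int hGm0 x, ← sub_eq_zero, ← integral_sub h1 h2]
    have hfun : (fun u : (mixedSpace K)ˣ => archChar K (u : mixedSpace K) x * (Gp u : ℂ) - archChar K (u : mixedSpace K) x * (Gm u : ℂ)) =
        fun u : (mixedSpace K)ˣ => archChar K (u : mixedSpace K) x * (G u : ℂ) := by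
      funext u
      rw [← mul_sub, ← Complex.ofReal_sub, hsub u]
    rw [hfun]
    exact h x
  have hρ : ρp = ρm :=
    measure_eq_of_forall_integral_cexp_bilin_eq (archCharForm K) archCharForm_nondegenerate htrans
  -- pull back along the measurable embedding: `νp = νm`
  have hν : νp = νm := by
    refine Measure.ext fun S hS => ?_
    have ep : νp S = ρp (Units.val '' S) := by
      rw [hρp, measurableEmbedding_units_val.map_apply, Set.preimage_image_eq _ Units.val_injective]
    have em : νm S = ρm (Units.val '' S) := by
      rw [hρm, measurableEmbedding_units_val.map_apply, Set.preimage_image_eq _ Units.val_injective]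
    rw [ep, em, hρ]
  -- equal densities
  have hdens : (fun u => ENNReal.ofReal (Gp u)) =ᵐ[μ] fun u => ENNReal.ofReal (Gm u) :=
    (withDensity_eq_iff hGp_int.1.aemeasurable.ennreal_ofReal hGm_int.1.aemeasurable.ennreal_ofReal hfinp).1 hν
  filter_upwards [hdens] with u hu
  have hu' := congrArg ENNReal.toReal hu
  rw [ENNReal.toReal_ofReal (hGp0 u), ENNReal.toReal_ofReal (hGm0 u)] at hu'
  -- `max (G u) 0 = max (-G u) 0` forces `G u = 0`
  change G u = 0
  simp only [hGp, hGm] at hu'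
  rcases le_total 0 (G u) with hpos | hneg
  · rw [max_eq_left hpos, max_eq_right (by linarith)] at hu'
    exact hu'
  · rw [max_eq_right hneg, max_eq_left (by linarith)] at hu'
    linarith

/-- **Complex case.** An integrable `F : K_∞ˣ → ℂ` with `∫ ψ_∞(u x) F(u) dμ = 0` for all `x ∈ K_∞`
vanishes a.e. (the real case applied to `Re F = (F + F̄)/2` and `Im F = (F - F̄)/(2i)`; the transforms of
`F̄` vanish too since `conj ψ_∞(u x) = ψ_∞(u(-x))`). [cite: Folland1995, Thm. 4.33] -/
theorem ae_eq_zero_of_forall_integral_archChar_mul (μ : Measure ((mixedSpace K)ˣ))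
    {F : (mixedSpace K)ˣ → ℂ} (hF : Integrable F μ)
    (h : ∀ x : mixedSpace K, ∫ u, archChar K (u : mixedSpace K) x * F u ∂μ = 0) :
    F =ᵐ[μ] 0 := by
  -- the transforms of `conj F` vanish as well
  have hconj : ∀ x : mixedSpace K, ∫ u, archChar K (u : mixedSpace K) x * conj (F u) ∂μ = 0 := by
    intro x
    have e : (fun u : (mixedSpace K)ˣ => archChar K (u : mixedSpace K) x * conj (F u)) =
        fun u : (mixedSpace K)ˣ => conj (archChar K (u : mixedSpace K) (-x) * F u) := by
      funext u
      rw [map_mul, conj_archChar, neg_neg]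
    rw [e, integral_conj, h (-x), map_zero]
  have hFc : Integrable (fun u : (mixedSpace K)ˣ => conj (F u)) μ := by
    simpa using Complex.conjCLE.toContinuousLinearMap.integrable_comp hF
  -- real and imaginary parts
  have hre : ∀ x : mixedSpace K, ∫ u, archChar K (u : mixedSpace K) x * ((F u).re : ℂ) ∂μ = 0 := by
    intro x
    have e : (fun u : (mixedSpace K)ˣ => archChar K (u : mixedSpace K) x * ((F u).re : ℂ)) =
        fun u : (mixedSpace K)ˣ => (2 : ℂ)⁻¹ * (archChar K (u : mixedSpace K) x * F u + archChar K (u : mixedSpace K) x * conj (F u)) := by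
      funext u
      rw [Complex.re_eq_add_conj]
      ring
    rw [e, integral_const_mul, integral_add (integrable_archChar_mul hF x) (integrable_archChar_mul hFc x),
      h x, hconj x, add_zero, mul_zero]
  have him : ∀ x : mixedSpace K, ∫ u, archChar K (u : mixedSpace K) x * ((F u).im : ℂ) ∂μ = 0 := by
    intro x
    have e : (fun u : (mixedSpace K)ˣ => archChar K (u : mixedSpace K) x * ((F u).im : ℂ)) =
        fun u : (mixedSpace K)ˣ => (2 * I : ℂ)⁻¹ * (archChar K (u : mixedSpace K) x * F u - archChar K (u : mixedSpace K) x * conj (F u)) := by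
      funext u
      rw [Complex.im_eq_sub_conj]
      ring
    rw [e, integral_const_mul, integral_sub (integrable_archChar_mul hF x) (integrable_archChar_mul hFc x),
      h x, hconj x, sub_zero, mul_zero]
  have hRe := ae_eq_zero_of_forall_integral_archChar_mul_real μ hF.re hre
  have hIm := ae_eq_zero_of_forall_integral_archChar_mul_real μ hF.im him
  filter_upwards [hRe, hIm] with u hu1 hu2
  change F u = 0
  apply Complex.ext
  · simpa using hu1
  · simpa using hu2

end Literature.NumberTheory.Automorphic
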